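import Mathlib
import HarnessLib
import HarnessLib.Audit
import Summits.AtomisticToContinuum.Statement
import HarnessLib.Audit.Status.Attr

/-!
Route: HiddenChargeMazur

CLOSED (refuted) 2026-08-17T13:30:36Z by planner-rchoice-AtomisticToContinuum-HiddenCha-ad0a93c3-0 — reason: refuted:stmt-AtomisticToContinuum-13511 (OddChargeExists) by Summit.AtomisticToContinuum.FouriersLaw.Theorems.not_OddChargeExists — note: route-choice (planner-rchoice-…-ad0a93c3): RETIRE, per the route's own KILL CRITERIA (a). OddChargeExists (13511) refuted-substantive by Theorems.not_OddChargeExists (p162374 @25ebc7474e19): OddChargeAlgebra.odd_law_coboundary — for lam ≠ 0 ≠ β and ANY ω₂ every momentum-odd POLYNOMIAL local conserva. The file is kept as the record of this route; refuted decls are indexed as negative knowledge (`ledger negatives`).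

# Route HiddenChargeMazur — refutation-shaped open-chain Mazur bridge — a momentum-odd local charge
leaks only through the two baths, so KDN identity + Thomson bound give D_N ≳ N and ¬FouriersLaw

REFUTATION route (opened with `--refutation`; deciding theorem `closes : BridgeGlue → StaticKubo →
ThomsonBound → DressedCharge → OddChargeExists → ¬ FouriersLaw`, proved in the planner folder,
standard axioms): the conforming re-filing of route-AtomisticToContinuum-OpenChainMazur (retired
2026-08-15T13:45Z `not-a-thesis`: its Assembly ended in the Literature constant and it carried no
deciding theorem), realising idea card open-chain-mazur-bridge. X = E ∧ B. E = OddChargeExists: at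
some admissible parameter point (ω₂, lam, β, γ > 0) and temperature T > 0 the INFINITE pinned chain
carries a finite-range POLYNOMIAL conserved density g, ODD under momentum reversal (local
conservation law `liouvilleZ P (g∘box_R) = ψ∘box_(R+1) − ψ∘box_(R+1)∘shift`), whose bulk charge Q_N
= Σ_x g(sites x..x+2R) has EXTENSIVE static overlap with the total current in the free-end N-chain
Gibbs state, |∫ J_N·Q_N dGibbs_(N,T)| ≥ cN. B = the open-chain Mazur bridge, split at open into
three fixed-N, theorem-grade statements over in-tree objects: StaticKubo (the Kundu–Dhar–Narayan
open-chain Green–Kubo identity in static Poisson-equation form, D_N·(N−1)T² = ∫F·J dGibbs with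
L_(T,T)F = −J), ThomsonBound (support: Cauchy–Schwarz for DRESSED test functions G, {H_N,G} = TΣ_b
∂*_(p_b) w_b) and DressedCharge (a charge, dressed by boundary-layer correctors, has overlap ≥ cN
and O(1) leak because charge and dissipation leave only through the two thermostatted momenta). E ∧
B ⇒ D_N ≥ c′N at that parameter point ⇒ ¬FouriersLawFor ⇒ ¬FouriersLaw. E is DISBELIEVED (pinning is
expected to leave energy as the only local conservation law); the route is the programme's formal
negative edge: it turns every discovered charge — and every certificate "no odd charge" — into a
statement about the CONJUNCT (today Mazur's obstruction reaches only the closed-chain κ_GK,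
MazurBoundBallistic scope caveat), and its expected fate `refuted:OddChargeExists` certifies "no
momentum-odd local conservation law with current overlap" as a NECESSARY condition of Fourier's law
in BLR's own formulation, leaving StaticKubo/ThomsonBound as proved instruments for the positive
routes.
Lean: `OddChargeExists ∧ StaticKubo ∧ ThomsonBound ∧ DressedCharge`

## Assembly
Refutation shape (D-0027 §2.1 with `--refutation`): OddChargeExists supplies (ω₂, lam, β, γ, T) > 0
and the charge; BridgeGlue turns StaticKubo, ThomsonBound, DressedCharge into OpenMazurBridge, i.e.
¬FouriersLawFor (pinnedChain ω₂ lam β γ); FouriersLaw instantiated at these parameters contradicts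
it — three lines of logic. `theorem closes (hG : BridgeGlue) (hK : StaticKubo) (hT : ThomsonBound)
(hD : DressedCharge) (hE : OddChargeExists) : ¬ _root_.FouriersLaw` and `assembly_of_glue :
BridgeGlue → Assembly` are PROVED in the planner folder (Sketch.lean, lean check rc 0, axioms
propext/Classical.choice/Quot.sound; #h21_check_closes ok, negative = true).

Rationale: WHY THIS LINE. Every positive FouriersLaw route records "a hidden odd conserved charge" as its
informal kill criterion, but the catalogued Mazur obstruction (Mazur1969; barrier
Mazur1969_inequality, narrow audit: on the finite open chain J = {H, Σ k·h_k} is a coboundary,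
finite-N Drude weights vanish) does not formally touch BLR's open-chain coefficient D_N. This line
makes the kill criterion a theorem about the conjunct by combining three published ideas under an
exact dictionary (skew part A = {H,·}, symmetric part S = the two OU baths, dressing =
bath-absorbability E[{H,G} | all but p_0, p_(N−1)] = 0): (K) the Kundu–Dhar–Narayan open-system
Green–Kubo identity (KunduDharNarayan2009 = arXiv:0809.4543 p.3: G = (k_B T²)⁻¹∫₀^∞⟨j̄(t)j̄(0)⟩dt
via the dipole identity dD_l/dt = −2j_(l+1,l) + 2J_b and detailed balance; re-derived by this
planner in static form from both ends, D·(N−1)·T² = ⟨F,J⟩_Gibbs = γTΣ_b‖∂_(p_b)F‖² ≥ 0); (V) the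
Sethuraman / Komorowski–Landim–Olla variational formula for non-reversible resolvents in its
one-sided Thomson form (BernardinOlla2011 §6 "Tauberian counterpart of Mazur inequality",
KomorowskiLandimOlla2012 Ch. 2, GaudilliereLandim2013) — imported from non-reversible potential
theory; (Q) Prosen's boundary-driven Mazur bound (Prosen2011, IlievskiProsen2012: quantum XXZ with
Lindblad ends) transplanted to the classical Langevin chain — imported from integrable-systems
charge bookkeeping: a bulk charge leaks charge and dissipation ONLY through p_0, p_(N−1), at rate
O(1), while its current overlap is O(N). What it does that the negatives index / prior routes do
not: it is the only line deciding the conjunct NEGATIVELY, and its cone is vocabulary-only (0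
unproved facts: #h21_route_deps in the planner folder).

RANKED CRUXES. #2 DressedCharge (crux) — card (Q)+(C2). For pinnedChain ω₂ lam β γ (all > 0) and T >
0 [every item binds `∀ P, P = pinnedChain ω₂ lam β γ →` to stay short — provers `subst` it]: IF
OddLocalCharge(ω₂,lam,β,γ,T) (∃ R, polynomial g on 2R+1 sites and ψ on 2R+3 sites, g odd under p ↦
−p, infinite-chain conservation law liouvilleZ P (g∘boxRestrict R) = ψ∘boxRestrict(R+1) −
ψ∘boxRestrict(R+1)∘shift, extensive finite-volume overlap c·N ≤ |∫ J_N·Q_N dGibbs_(N,T)| for N ≥ N₀)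
THEN ∃ c > 0, C, N₀ such that for every N ≥ N₀ there are C² functions G, wL, wR on PhaseSpace N with
e^(θH) growth (values and first partials, θ < 1/(2T)) that are DRESSED — {H_N, G} = T(∂*_(p_0) wL +
∂*_(p_(N−1)) wR) pointwise, ∂*_p w := −∂_p w + (p/T)w — with current overlap ∫ J_N G dGibbs ≥ cN and
leak T Σ_b ∫(γ′∂_(p_b)G + w_b)² dGibbs ≤ C(1+γ′²) for all γ′. Intended construction G = (Q_N +
boundary-layer correctors)/const; by Thomson sharpness the item is equivalent, given StaticKubo, to
D_N ≳ N at parameters carrying a charge (harmonic calibration: G = F_odd/N works, D_N ≍ N proved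
there). [difficulty: L] (why it might fail: Cohomological obstruction at the FREE ends: E[{H_N,Q_N}
| all but p_0,p_(N-1)] may lie outside the range of w ↦ E[{H_N,w} | ·] over boundary-local
correctors; then only the undressed resolvent bound at ν_N ~ N^(-1/2) survives and
positivity/Tauberian input is needed.) [Prosen2011, IlievskiProsen2012, BernardinOlla2011,
KomorowskiLandimOlla2012, KunduDharNarayan2009]
#3 StaticKubo (crux) — card (K), Poisson-equation form, fixed N (theorem-grade; the open-chain
Green–Kubo identity every positive route wants). For pinnedChain (all > 0), under weak-NESS
uniqueness (the μ = ν form), for every steady-state family μ, T > 0, N ≥ 2 and every D that IS the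
response limit lim_(δ→0, δ≠0) totalCurrent(μ N (T+δ/2) (T−δ/2))/δ: there is F ∈ C²(PhaseSpace N)
with |F|, |∂F| ≤ C e^(θH), θ < 1/(2T), solving generator N T T F = −J pointwise (J = Σ_i bondCurrent
i) and D·(N−1)T² = ∫ F·J dGibbs_(N,T) (= γT Σ_b ‖∂_(p_b)F‖² ≥ 0). Sketch (planner-derived,
cross-checked against KDN p.3): F := ∫₀^∞ P_t J dt; weak stationarity of μ_δ applied to F gives
totalCurrent(μ_δ) = δ∫BF dμ_δ with B = (γ/2)(∂²_(p_0) − ∂²_(p_(N−1))); continuity μ_δ → Gibbs on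
e^(θH)-observables; Gaussian integration by parts D = T⁻²⟨F, (γ/2)(p_0² − p²_(N−1))⟩; energy dipoles
from both ends + L† = ΘLΘ + ⟨J, dipole⟩ = 0 by parity give ⟨F,J⟩ = (N−1)T²D. [difficulty: L] (why it
might fail: Infrastructure only: continuity of the NESS at δ=0 on e^(θH)-observables and GRADIENT
e^(θH)-bounds (θ<1/(2T)) for the Poisson solution ∫P_tJ dt (hypoelliptic/Bismut gradient estimates)
are unvendored; a normalisation slip would show in the harmonic corner.) [KunduDharNarayan2009,
ReyBellet2003, HairerMajda2009, CuneoEckmannHairerReyBellet2018, BonettoLebowitzReyBellet2000]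
#4 OddChargeExists (crux) — the EXISTENCE CLAUSE = kill switch (DISBELIEVED; filed so that the Mazur
loophole becomes decisive for the conjunct): ∃ ω₂, lam, β, γ, T > 0 with
OddLocalCharge(ω₂,lam,β,γ,T) as in DressedCharge (odd polynomial finite-range density,
infinite-chain local conservation law, extensive finite-volume current overlap). Expected FALSE:
pinning is believed to leave energy as the only local conservation law (DicintioEtAl2018;
MazurBoundBallisticNarrow (5)); its adversaries are the classification statements of the
no-hidden-charges / local-Ohm cards (an odd f = c·e_0 + (h − h∘shift) + k forces c = k = 0 and Q_N
telescopes to O(1) overlap). A proof at one parameter point makes this route refute FouriersLaw; a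
refutation closes the route with the bridge items standing. [difficulty: open-problem] (why it might
fail: Expected false: no momentum-odd local conservation law is known or expected for the quartic
pinned chain at any positive parameters (pinning destroys the harmonic/Toda charges); a
NoLocalIntegrals-type classification refutes it outright.) [Mazur1969, Zotos2002, DicintioEtAl2018,
Yamilov2006, LepriLiviPoliti2003]
#9 ThomsonBound (support) — card (V), static one-sided Thomson form (routine). For pinnedChain (all
> 0), T > 0, any N and C² functions F, G, wL, wR with a common e^(θH) bound (θ < 1/(2T)): if
generator N T T F = −J pointwise and G is dressed, {H_N,G} = T Σ_b ∂*_(p_b) w_b, then γ(∫ J G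
dGibbs)² ≤ (∫ F J dGibbs)·(T Σ_b ∫ (γ∂_(p_b)G + w_b)² dGibbs). Proof: ∫FJ = −∫F·LF = γTΣ_b∫(∂_bF)²
(Liouville antisymmetry + OU integration by parts in L²(Gibbs), in-tree pattern
integral_liouville_mul_gibbsDensity / integral_bath_mul_gibbsDensity extended to the e^(θH) class by
cutoffs); ∫JG = −∫(LF)G = ∫F·{H,G} + γTΣ_b∫∂_bF∂_bG = TΣ_b∫∂_bF(w_b + γ∂_bG) since poisson H G = A G
in tree; Cauchy–Schwarz. Sharp at G = F_odd, w_b = γ∂_(p_b)F_even. N = 0, 1 read 0 ≤ 0. [difficulty: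
M] [BernardinOlla2011, KomorowskiLandimOlla2012, GaudilliereLandim2013]
#9 OpenMazurBridge (support) — THE INSTRUMENT, stated alone so positive routes and refuters can cite
it: for pinnedChain ω₂ lam β γ (all > 0) and T > 0, OddLocalCharge(ω₂,lam,β,γ,T) ⟹ ¬FouriersLawFor
(pinnedChain ω₂ lam β γ). Follows from StaticKubo, ThomsonBound, DressedCharge by BridgeGlue;
contrapositively FouriersLawFor ⇒ no odd polynomial local charge with extensive current overlap —
the certified NECESSARY condition, the open-chain reach the Mazur barrier lacked. [difficulty: M]
[KunduDharNarayan2009, Prosen2011, Mazur1969]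
#9 BridgeGlue (support) — GLUE (~120 Lean lines, bookkeeping): StaticKubo → ThomsonBound →
DressedCharge → OpenMazurBridge. Given the charge at (ω₂,lam,β,γ,T), assume h : FouriersLawFor
(pinnedChain …). Clause (i) of h gives weak-NESS uniqueness (μ = ν form) and, by choice, a
steady-state family; clause (ii) gives κ and D : ℕ → ℝ with the response limits at T and Tendsto D
atTop (nhds (κ T)), hence |D N| ≤ M. DressedCharge gives c, C, N₀; for N ≥ max N₀ 2 take F from
StaticKubo (D := D N) and G, wL, wR from DressedCharge (common growth constants by max);
ThomsonBound yields γ(cN)² ≤ γ(∫JG)² ≤ D N·(N−1)T²·leak(γ) ≤ M(N−1)T²C(1+γ²) (leak ≥ 0 as a sum of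
integrals of squares; ∫FJ < 0 is already absurd), i.e. N ≤ M T² C(1+γ²)/(γc²)·(N−1)/N — false for
large N. [difficulty: M] [BonettoLebowitzReyBellet2000, KunduDharNarayan2009]
#9 NoOddChargeSmallRange (support) — NEGATIVE SIDE of OddChargeExists in the first window (the
card's detection protocol; decidable by symbolic linear algebra; the cheapest falsifier recorded as
an item): for all ω₂, lam, β, γ, T > 0, every odd polynomial 3-site density g of total degree ≤ 4
with a local conservation law of the infinite pinned chain (flux ψ polynomial on 5 sites) has
sub-extensive finite-volume current overlap (∀ c > 0 ∀ N₀ ∃ N ≥ N₀, |∫ J_N·Q_N dGibbs| < cN).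
Expected proof: (a) the nullspace of `liouvilleZ(g∘box₁) = ψ∘box₂ − ψ∘box₂∘shift` in coefficient
space over ℝ(ω₂, lam, β) consists of coboundaries once lam, β > 0 (the harmonic solution g = j_0,
degree 2, must be seen to disappear; mind non-generic parameter values); (b) coboundary charges
telescope, Q_N = h(left window) − h(right window), and E_N[J_N·(…)] = O(1) uniformly in N (momentum
independence kills all but O(1) bonds; uniform moments of the free-end Gibbs marginals). A
counterexample at positive parameters flips the route into a live refutation of the conjunct.
[difficulty: M] [Yamilov2006, DicintioEtAl2018, Mazur1969]

TWO-LAYER PLAN. Layer 1 = the three cruxes + four supports + `closes`. Foreseen glued split (k = 2)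
once staffed: DressedCharge ⇐ BulkOverlap (static 1-D Gibbs bounds for Q_N: overlap ≍ N, ‖Q_N‖² =
O(N), transfer-operator clustering uniform in N) → EndDressing (the boundary-corrector linear
algebra, first in the harmonic calibration f = j_0) → DressedCharge. StaticKubo ⇐ PoissonSolution (F
= ∫P_tJ, C² with e^(θH) value and gradient bounds) → ResponseIdentity (weak stationarity +
continuity at δ = 0 + the two-ended dipole computation) → StaticKubo.

KILL CRITERIA. (a) EXPECTED: a proof of a NoLocalIntegrals / LocalChargeClassification-type
statement (every smooth or polynomial local conservation law of the infinite pinned chain is c·e_0 +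
coboundary + const at ALL positive parameters) refutes OddChargeExists (odd ⇒ c = 0 ⇒ pure
coboundary ⇒ O(1) overlap) ⇒ close `refuted:OddChargeExists`; BEFORE closing, the tenure planner
re-asks StaticKubo / ThomsonBound / OpenMazurBridge on the positive routes that want them
(FourierGreenKubo clause (ii), Fekete/superadditive PositiveConductance via D_N ≥ 0, every route's
informal kill criterion) so the proved instruments survive as shared items. (b) A refutation of
DressedCharge by an explicit free-end obstruction (computable first in the harmonic calibration,
where D_N ≍ N is PROVED: HarmonicChainBallisticFlux.not_hasBoundedResponse, so a dressed G = F_odd/N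
exists there — an obstruction can only concern the boundary-LOCAL ansatz) is `misstated`: restate as
the resolvent/positivity split (card's C1: ν_N ≍ N^(−1/2) bound + current-autocorrelation positivity
or Tauberian regularity), not close. (c) A refutation of StaticKubo's identity in the harmonic
corner (closed Gaussian forms, HarmonicChainFlux) is `misstated`: restate with the corrected
normalisation. (d) FouriersLaw PROVED by any positive route moots the route and turns
OpenMazurBridge's contrapositive into an unconditional classification corollary.

NOT DECOMPOSED YET. The resolvent (ν > 0) variational bound and the closing alternatives (C1)
current-autocorrelation positivity / Tauberian regularity of the open-chain current spectral measure
near 0; the 1-D Gibbs bookkeeping inside DressedCharge (free-end finite-volume vs DLR expectations,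
transfer-operator clustering); the dressing linear algebra as its own item; the quasi-local
(Prosen–Ilievski) charge alarm min‖{H,Q}‖²/‖Q‖² over odd densities of range ≤ r (a quasi-conserved
sequence with fast-decaying leak would also force D_N → ∞ — a possible later weakening of
OddChargeExists, deliberately not filed); T- and γ-dependence of constants; the time-domain KDN
statement in the tree's KuboFormula / pinnedChainSemigroup language (gen-1 support KuboIdentity) is
deliberately NOT re-filed: it would pull the Langevin-SDE semigroup construction into the cone, and
StaticKubo carries the same content statically.

CHEAPEST FALSIFIER. (1) NoOddChargeSmallRange itself (sympy, rational arithmetic, an afternoon):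
nullspace of the conservation-law system on odd 3-site densities of degree ≤ 4 for symbolic (ω₂,
lam, β) — a nontrivial solution at positive parameters flips the route into a live refutation of the
conjunct; an empty nullspace is the expected first certificate. (2) Harmonic calibration of
StaticKubo/ThomsonBound conventions: at lam = β = 0 everything is Gaussian — compare D_N from the
HarmonicChainFlux closed forms with ∫F·J for the quadratic F solving LF = −J (linear algebra in 2N
dimensions, N = 2..6); a mismatch kills the normalisation (planner re-derived D·(N−1)·T² = ⟨F,J⟩ by
hand from both ends and against KDN p.3, G = (k_BT²)⁻¹∫⟨j̄(t)j̄(0)⟩dt with j̄ = J/(N−1)). Not run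
here (compute-free hub, one-shot planning unit).

NUMBERS. Harmonic corner (lam = β = 0): D_N = (N−1)·c_N ≍ N (HarmonicChainBallisticFlux,
RiederLebowitzLieb1967) — the exponent the dressed bridge must reproduce; undressed resolvent bound
gives ≥ N^(1/2) (card). KDN: G = (k_BT²)⁻¹∫₀^∞⟨j̄(t)j̄(0)⟩dt, j̄ = J/(N−1) (arXiv:0809.4543 p.3),
i.e. D·(N−1)·T² = ∫₀^∞⟨J(t)J(0)⟩dt = ⟨F,J⟩ in the tree's normalisation (totalCurrent = (N−1)j̄).
Items at open: 8 (3 cruxes, 4 supports, 1 assembly) + closes. Cone: gate deps check = 32 project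
constants, 0 unproved (staffable). Route-repair 2026-08-15 (planner-rrepair-…-9f4a7eaf): the six
vocabulary-using items (DressedCharge, StaticKubo, OddChargeExists, ThomsonBound, OpenMazurBridge,
NoOddChargeSmallRange) were RESTATED BY DEFINITIONAL UNFOLDING — kernel-checked `example : New ↔ Old
:= Iff.rfl` for each against the rev-0 decls (planner folder SketchEquiv.lean, lean check rc 0) — so
that the route file imports NOTHING beyond the Statement: its module import cone is now exactly the
summit Statement's (the reconciler's import-cone guardrail had counted 4 unproved named facts in the
wider cone pulled in by LangevinChainGibbs → LangevinChainNESSProofs →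
LangevinChainNESS/LangevinSemigroup, PhaseSpacePoisson, and InfiniteChainInvariantStates →
InfiniteChainDynamics → GibbsSpecification/IsingModel/LatticeGraph/Correlations; none of those facts
is used by any item). BridgeGlue is re-filed verbatim up to parenthesisation (`StaticKubo →
(ThomsonBound → (DressedCharge → OpenMazurBridge))`, the same term) only so that it is declared
after the restated supports it names; Assembly and `closes` are unchanged.

DEFINITION REQUESTS. None. VOCABULARY DICTIONARY for provers/refuters (fold back in Theorems files,
which may import the vocabulary modules freely): `(MeasureTheory.volume : Measure (PhaseSpace
N)).tilted (fun x => -P.hamiltonian N x / T)` IS `P.gibbsMeasure N T` (LangevinChainGibbs,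
`OscillatorChain.gibbsMeasure_eq`, proof `rfl`); `∑ x : Fin N, (partialP x (P.hamiltonian N) z *
partialQ x G z - partialQ x (P.hamiltonian N) z * partialP x G z)` IS `poisson (P.hamiltonian N) G
z` (PhaseSpacePoisson, `unfold poisson`); `σ : ℤ → ℝ × ℝ` IS `ChainConfig`; `fun i => σ ((i : ℤ) -
(R : ℕ))` IS `boxRestrict R σ`; `fun x => σ (x + 1)` IS `shift σ`; the `∑' x : ℤ, ((σ x).2 * deriv
(fun t => g (…update σ x (t, (σ x).2)…)) (σ x).1 + (-deriv P.U (σ x).1 + (deriv P.V ((σ (x+1)).1 -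
(σ x).1) - deriv P.V ((σ x).1 - (σ (x-1)).1))) * deriv (fun t => g (…update σ x ((σ x).1, t)…)) (σ
x).2)` expression IS `liouvilleZ P (g ∘ boxRestrict R) σ` (InfiniteChainInvariantStates: liouvilleZ,
partialQZ, partialPZ; InfiniteChainDynamics: force, interactionForce — `unfold` / `rfl`). So a
prover's first line `show <vocabulary form>` or `rw [← OscillatorChain.gibbsMeasure_eq]` recovers
the whole LangevinChainGibbs / PhaseSpacePoisson API. generator, bondCurrent, totalCurrent,
IsSteadyState, FouriersLawFor, pinnedChain, hamiltonian, partialP, partialQ (FouriersLaw.lean,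
imported through the Statement) are used as is; OddLocalCharge stays inlined (a named `def` would be
a Theorems-side definition request later, if provers want it).

Novelty: Searches (2026-08-15, this planner): `lit search --hybrid "Green-Kubo formula open system boundary
driven chain Langevin heat baths conserved quantity lower bound conductivity diverges ballistic
Mazur"` (12 textbook hits only: dorfman1999, balakrishnan2020, gaspard2022, livi2017/2025, …); `lit
search --source crossref "Green-Kubo formula heat conduction open systems Langevin baths exact
linear response Kundu Dhar Narayan"` (12: KDN 2009 doi:10.1088/1742-5468/2009/03/l03001 =
arXiv:0809.4543; Dhar–Narayan–Kundu–Saito 2011 doi:10.1103/physreve.83.011101 finite-frequency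
version; Narayan 2011 doi:10.1103/physreve.83.061110 general open-system linear response; Kundu 2010
arXiv:1009.0366 boundary-current autocorrelation of the disordered HARMONIC open chain — exact
Gaussian formulas, no variational/charge bound; Jakšić–Ogata–Pillet 2007
doi:10.1007/s00023-007-0327-7 quantum open-system GK); openalex / s2 legs rate-limited today (HTTP
429, recorded); `lit read arxiv:0809.4543` p.3 (G = (k_BT²)⁻¹∫⟨j̄(t)j̄(0)⟩, dipole identity,
Novikov, detailed balance); `lit read arxiv:1009.0366 --grep`; `lit frontier AtomisticToContinuum
--since 2021` (30 rows: Bose gas, hard spheres, arXiv:2310.13338 heat equation from deterministic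
dynamics, arXiv:2604.14056 specific heat of driven chains — none on open-chain Mazur/KDN); `lit
bridges AtomisticToContinuum --cross any` (nothing related); `lean search` for every constant; plus
the card author's searches, the refuter novelty audit of the card (Berna  [refs: 10.1088/1742-5468/2009/03/l03001, 10.1103/physreve.83.011101, 10.1103/physreve.83.061110, 10.1007/s00023-007-0327-7, 10.1103/physrevlett.106.217206, 10.1016/0031-8914(73, 0809.4543, 1009.0366, 2310.13338, 2604.14056, 1105.0493, doi:10.1088/1742-5468/2009/03/l03001, doi:10.1103/physreve.83.011101, doi:10.1103/physreve.83.061110, doi:10.1007/s00023-007-0327-7, arxiv:0809.4543, arxiv:1009.0366, doi:1]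

Barriers (technique_class: open-chain-kubo thomson-bound dressed-bulk-charge): - technique_class: open-chain-kubo thomson-bound dressed-bulk-charge
- Literature.Barriers.AtomisticToContinuum.Mazur1969_inequality: not evaded but EXTENDED — the route
weaponises the obstruction for the open chain; the narrow audit (MazurBoundBallisticNarrow (4): J is
a coboundary on the finite open chain, finite-N Drude weight 0) is respected: the witness Q_N is NOT
conserved in the finite chain, it leaks at the free ends, and ⟨J,Q_N⟩ = −⟨Σk·h_k, {H,Q_N}⟩ ≍ N is
consistent with J = {H, Σk·h_k}; conjunct (5) (fixed size vs thermodynamic limit) is met by carrying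
the N-dependence explicitly (overlap ≍ N vs leak O(1)).
- Literature.Barriers.AtomisticToContinuum.HasBoundedResponse: the route contradicts bounded
response in contrapositive form inside BridgeGlue (D_N ≥ c′N against D_N → κ(T)); the fixed-N
ingredients (StaticKubo, ThomsonBound) are legitimate because the conclusion is N-explicit through
the charge, not through any fixed-N constant — the barrier says fixed-N tools cannot prove
FouriersLaw, and this route does not try to.
- Literature.Barriers.AtomisticToContinuum.HarmonicChainBallisticFlux: the calibration corner (f =
j_0 is an odd range-2 conserved density of the harmonic chain with overlap ½T·C(0)(1−a²) > 0; D_N ≍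
N proved there) — a regression test for StaticKubo's normalisation and for the dressing ansatz;
formally outside the cruxes' range (β > 0).
- Literature.Barriers.AtomisticToContinuum.BeckerMenegaki2022_gapClosing: evaded — no rate or gap is
used; the s

History (route lifecycle, newest last):
- 2026-08-15T19:18:21Z · rev 1: restated DressedCharge (stmt-AtomisticToContinuum-12117), StaticKubo (stmt-AtomisticToContinuum-12118), OddChargeExists (stmt-AtomisticToContinuum-12119), ThomsonBound (stmt-AtomisticToContinuum-12120), OpenMazurBridge (stmt-AtomisticToContinuum-12121), NoOddChargeSmallRange (stmt-AtomisticToContinuum-12123), Br (planner-rrepair-AtomisticToContinuum-HiddenCha-9f4a7eaf-0)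
- 2026-08-17T13:11:09Z · BROKEN — OddChargeExists (stmt-AtomisticToContinuum-13511, crux) refuted by Summit.AtomisticToContinuum.FouriersLaw.Theorems.not_OddChargeExists @ 25ebc7474e19 (prover-line-stmt-AtomisticToContinuum-13511-c1-0)
- 2026-08-17T13:30:36Z · CLOSED refuted — refuted:stmt-AtomisticToContinuum-13511 (OddChargeExists) by Summit.AtomisticToContinuum.FouriersLaw.Theorems.not_OddChargeExists (planner-rchoice-AtomisticToContinuum-HiddenCha-ad0a93c3-0)

sub-problem: FouriersLaw · status: closed(refuted) · opened planner-plancard-AtomisticToContinuum-Fourier-16e0648b-g2-0 2026-08-15T18:49:48Z · rev 1 · ledger route-AtomisticToContinuum-HiddenChargeMazur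
GENERATED by the gate from the ledger (D-0016/17). Provers cite these decls: `theorem foo : Summit.AtomisticToContinuum.FouriersLaw.Theses.HiddenChargeMazur.<Decl> := …` in Summits/AtomisticToContinuum/FouriersLaw/Theorems/<Name>.lean.
-/

namespace Summit.AtomisticToContinuum.FouriersLaw.Theses.HiddenChargeMazur

open scoped BigOperators Topology Manifold Classical MeasureTheory ProbabilityTheory Matrix InnerProductSpace ComplexConjugate ContinuousMap
open Filter Set Function TopologicalSpace MeasureTheory

attribute [summit_statement] _root_.FouriersLaw

-- earlier DressedCharge (stmt-AtomisticToContinuum-12117, replaced 2026-08-15T19:18:21Z -> stmt-AtomisticToContinuum-13509): retired by None — ∀ ω₂ lam β γ T : ℝ, 0 < ω₂ → 0 < lam → 0 < β → 0 < γ → 0 < T → ∀ P : Literature.MathematicalPhysics.KineticTheory.HeatConduction.OscillatorChain, P = Literature.MathematicalPhysics.KineticTheory.HeatConduction.pinnedChain ω₂ lam β γ → (∃ (R : ℕ) (g : (Fin (2 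
/-- item stmt-AtomisticToContinuum-13509 · crux · rank 2 · closed · proved by Summit.AtomisticToContinuum.FouriersLaw.Theorems.dressedCharge_proof @ 5083abf1f5f8 (prover) · by planner
why it might fail: Cohomological obstruction at the FREE ends: E[{H_N,Q_N} | all but p_0,p_(N-1)] may lie outside the range of w ↦ E[{H_N,w} | ·] over boundary-local correctors; then only the undressed resolvent bound at ν_N ~ N^(-1/2) survives and positivity/Tauberian input is needed.
sources: Prosen2011, IlievskiProsen2012, BernardinOlla2011, KomorowskiLandimOlla2012, KunduDharNarayan2009
[crux] card (Q)+(C2). For pinnedChain ω₂ lam β γ (all > 0) and T > 0 [every item binds `∀ P, P =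
pinnedChain ω₂ lam β γ →` to stay short — provers `subst` it]: IF OddLocalCharge(ω₂,lam,β,γ,T) (∃ R,
polynomial g on 2R+1 sites and ψ on 2R+3 sites, g odd under p ↦ −p, infinite-chain conservation law
liouvilleZ P (g∘boxRestrict R) = ψ∘boxRestrict(R+1) − ψ∘boxRestrict(R+1)∘shift, extensive
finite-volume overlap c·N ≤ |∫ J_N·Q_N dGibbs_(N,T)| for N ≥ N₀) THEN ∃ c > 0, C, N₀ such that for
every N ≥ N₀ there are C² functions G, wL, wR on PhaseSpace N with e^(θH) growth (values and first
partials, θ < 1/(2T)) that are DRESSED — {H_N, G} = T(∂*_(p_0) wL + ∂*_(p_(N−1)) wR) pointwise, ∂*_p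
w := −∂_p w + (p/T)w — with current overlap ∫ J_N G dGibbs ≥ cN and leak T Σ_b ∫(γ′∂_(p_b)G + w_b)²
dGibbs ≤ C(1+γ′²) for all γ′. Intended construction G = (Q_N + boundary-layer correctors)/const; by
Thomson sharpness the item is equivalent, given StaticKubo, to D_N ≳ N at parameters carrying a
charge (harmonic calibration: G = F_odd/N works, D_N ≍ N proved there). [difficulty: L] -/
@[route_item "route-AtomisticToContinuum-HiddenChargeMazur", crux]
def DressedCharge : Prop :=
  ∀ ω₂ lam β γ T : ℝ, 0 < ω₂ → 0 < lam → 0 < β → 0 < γ → 0 < T → ∀ P : Literature.MathematicalPhysics.KineticTheory.HeatConduction.OscillatorChain, P = Literature.MathematicalPhysics.KineticTheory.HeatConduction.pinnedChain ω₂ lam β γ → (∃ (R : ℕ) (g : (Fin (2 * R + 1) → ℝ × ℝ) → ℝ) (ψ : (Fin (2 * (R + 1) + 1) → ℝ × ℝ) → ℝ), (∃ p : MvPolynomial (Fin (2 * R + 1) ⊕ Fin (2 * R + 1)) ℝ, ∀ y : Fin (2 * R + 1) → ℝ × ℝ, g y = MvPolynomial.eval (Sum.elim (fun i => (y i).1)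 (fun i => (y i).2)) p) ∧ (∃ p : MvPolynomial (Fin (2 * (R + 1) + 1) ⊕ Fin (2 * (R + 1) + 1)) ℝ, ∀ y : Fin (2 * (R + 1) + 1) → ℝ × ℝ, ψ y = MvPolynomial.eval (Sum.elim (fun i => (y i).1) (fun i => (y i).2)) p) ∧ (∀ y : Fin (2 * R + 1) → ℝ × ℝ, g (fun i => ((y i).1, -(y i).2)) = -g y) ∧ (∀ σ : ℤ → ℝ × ℝ, (∑' x : ℤ, ((σ x).2 * deriv (fun t => g (fun i : Fin (2 * R + 1) => Function.update σ x (t, (σ x).2) ((i : ℤ) - (R : ℕ)))) (σ x).1 + (-deriv P.U (σ x).1 + (deriv P.V ((σ (x + 1)).1 - (σ x).1) - deriv P.V ((σ x).1 - (σ (x - 1)).1))) * deriv (fun t => g (fun i : Fin (2 * R + 1) => Function.update σ x ((σ x).1, t) ((i : ℤ) - (R : ℕ)))) (σ x).2)) = ψ (fun i : Fin (2 * (R + 1) + 1) => σ ((i : ℤ) - (R + 1 : ℕ))) - ψ (fun i : Fin (2 * (R + 1) + 1) => σ ((i : ℤ) - (R + 1 : ℕ) + 1))) ∧ (∃ c :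 ℝ, 0 < c ∧ ∃ N₀ : ℕ, ∀ N : ℕ, N₀ ≤ N → c * (N : ℝ) ≤ |∫ z, (∑ i : Fin N, P.bondCurrent N i z) * (∑ x ∈ Finset.range (N - 2 * R), g (fun i => if h : x + i.val < N then (z.1 ⟨x + i.val, h⟩, z.2 ⟨x + i.val, h⟩) else (0, 0))) ∂(MeasureTheory.volume.tilted fun x => -P.hamiltonian N x / T)|)) → ∃ c C : ℝ, 0 < c ∧ ∃ N₀ : ℕ, ∀ N : ℕ, N₀ ≤ N → ∃ G wL wR : Literature.MathematicalPhysics.KineticTheory.HeatConduction.PhaseSpace N → ℝ, ContDiff ℝ 2 G ∧ ContDiff ℝ 2 wL ∧ ContDiff ℝ 2 wR ∧ (∃ C θ : ℝ, θ < 1 / (2 * T) ∧ ∀ (z : Literature.MathematicalPhysics.KineticTheory.HeatConduction.PhaseSpace N) (i : Fin N), |G z| + |wL z| + |wR z| + |Literature.MathematicalPhysics.KineticTheory.HeatConduction.partialP i G z| + |Literature.MathematicalPhysics.KineticTheory.HeatConduction.partialQ i G z| + |Literature.MathematicalPhysics.KineticTheory.HeatConduction.partialP i wL z| + |Literature.MathematicalPhysics.KineticTheory.HeatConduction.partialQ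 i wL z| + |Literature.MathematicalPhysics.KineticTheory.HeatConduction.partialP i wR z| + |Literature.MathematicalPhysics.KineticTheory.HeatConduction.partialQ i wR z| ≤ C * Real.exp (θ * P.hamiltonian N z)) ∧ (∀ z : Literature.MathematicalPhysics.KineticTheory.HeatConduction.PhaseSpace N, (∑ x : Fin N, (Literature.MathematicalPhysics.KineticTheory.HeatConduction.partialP x (P.hamiltonian N) z * Literature.MathematicalPhysics.KineticTheory.HeatConduction.partialQ x G z - Literature.MathematicalPhysics.KineticTheory.HeatConduction.partialQ x (P.hamiltonian N) z * Literature.MathematicalPhysics.KineticTheory.HeatConduction.partialP x G z)) = T * ∑ i : Fin N, ((if i.val = 0 then -Literature.MathematicalPhysics.KineticTheory.HeatConduction.partialP i wL z + z.2 i / T * wL z else 0) + (if i.val = N - 1 then -Literature.MathematicalPhysics.KineticTheory.HeatConduction.partialP i wR z + z.2 i / T * wR z else 0))) ∧ c * (N : ℝ) ≤ ∫ z, (∑ i : Fin N, P.bondCurrent N i z) * G z ∂(MeasureTheory.volume.tilted fun x => -P.hamiltonian N x / T) ∧ ∀ γ' : ℝ, T * ∑ i : Fin N, ((if i.val = 0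 then ∫ z, (γ' * Literature.MathematicalPhysics.KineticTheory.HeatConduction.partialP i G z + wL z) ^ 2 ∂(MeasureTheory.volume.tilted fun x => -P.hamiltonian N x / T) else 0) + (if i.val = N - 1 then ∫ z, (γ' * Literature.MathematicalPhysics.KineticTheory.HeatConduction.partialP i G z + wR z) ^ 2 ∂(MeasureTheory.volume.tilted fun x => -P.hamiltonian N x / T) else 0)) ≤ C * (1 + γ' ^ 2)

-- earlier StaticKubo (stmt-AtomisticToContinuum-12118, replaced 2026-08-15T19:18:21Z -> stmt-AtomisticToContinuum-13510): retired by None — ∀ ω₂ lam β γ : ℝ, 0 < ω₂ → 0 < lam → 0 < β → 0 < γ → ∀ P : Literature.MathematicalPhysics.KineticTheory.HeatConduction.OscillatorChain, P = Literature.MathematicalPhysics.KineticTheory.HeatConduction.pinnedChain ω₂ lam β γ → (∀ (N : ℕ) (T_L T_R : ℝ), 0 < T_L → 0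
/-- item stmt-AtomisticToContinuum-13510 · crux · rank 3 · closed · proved by Summit.AtomisticToContinuum.FouriersLaw.Cruxes.StaticKubo.Birth.StaticKubo_skeleton @ d1ebb9675ac2 (prover) · by planner
why it might fail: Infrastructure only: continuity of the NESS at δ=0 on e^(θH)-observables and GRADIENT e^(θH)-bounds (θ<1/(2T)) for the Poisson solution ∫P_tJ dt (hypoelliptic/Bismut gradient estimates) are unvendored; a normalisation slip would show in the harmonic corner.
sources: KunduDharNarayan2009, ReyBellet2003, HairerMajda2009, CuneoEckmannHairerReyBellet2018, BonettoLebowitzReyBellet2000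
[crux] card (K), Poisson-equation form, fixed N (theorem-grade; the open-chain Green–Kubo identity
every positive route wants). For pinnedChain (all > 0), under weak-NESS uniqueness (the μ = ν form),
for every steady-state family μ, T > 0, N ≥ 2 and every D that IS the response limit lim_(δ→0, δ≠0)
totalCurrent(μ N (T+δ/2) (T−δ/2))/δ: there is F ∈ C²(PhaseSpace N) with |F|, |∂F| ≤ C e^(θH), θ <
1/(2T), solving generator N T T F = −J pointwise (J = Σ_i bondCurrent i) and D·(N−1)T² = ∫ F·J
dGibbs_(N,T) (= γT Σ_b ‖∂_(p_b)F‖² ≥ 0). Sketch (planner-derived, cross-checked against KDN p.3): F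
:= ∫₀^∞ P_t J dt; weak stationarity of μ_δ applied to F gives totalCurrent(μ_δ) = δ∫BF dμ_δ with B =
(γ/2)(∂²_(p_0) − ∂²_(p_(N−1))); continuity μ_δ → Gibbs on e^(θH)-observables; Gaussian integration
by parts D = T⁻²⟨F, (γ/2)(p_0² − p²_(N−1))⟩; energy dipoles from both ends + L† = ΘLΘ + ⟨J, dipole⟩
= 0 by parity give ⟨F,J⟩ = (N−1)T²D. [difficulty: L] -/
@[route_item "route-AtomisticToContinuum-HiddenChargeMazur"]
def StaticKubo : Prop :=
  ∀ ω₂ lam β γ : ℝ, 0 < ω₂ → 0 < lam → 0 < β → 0 < γ → ∀ P : Literature.MathematicalPhysics.KineticTheory.HeatConduction.OscillatorChain, P = Literature.MathematicalPhysics.KineticTheory.HeatConduction.pinnedChain ω₂ lam β γ → (∀ (N : ℕ) (T_L T_R : ℝ), 0 < T_L → 0 < T_R → ∀ μ ν : MeasureTheory.Measure (Literature.MathematicalPhysics.KineticTheory.HeatConduction.PhaseSpace N), P.IsSteadyState N T_L T_R μ → P.IsSteadyState N T_L T_R ν → μ = ν) → ∀ μ : (N : ℕ) → ℝ → ℝ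 → MeasureTheory.Measure (Literature.MathematicalPhysics.KineticTheory.HeatConduction.PhaseSpace N), (∀ (N : ℕ) (T_L T_R : ℝ), 0 < T_L → 0 < T_R → P.IsSteadyState N T_L T_R (μ N T_L T_R)) → ∀ T : ℝ, 0 < T → ∀ N : ℕ, 2 ≤ N → ∀ D : ℝ, Filter.Tendsto (fun δ : ℝ => P.totalCurrent (μ N (T + δ / 2) (T - δ / 2)) / δ) (nhdsWithin 0 {(0 : ℝ)}ᶜ) (nhds D) → ∃ F : Literature.MathematicalPhysics.KineticTheory.HeatConduction.PhaseSpace N → ℝ, ContDiff ℝ 2 F ∧ (∃ C θ : ℝ, θ < 1 / (2 * T) ∧ ∀ (z : Literature.MathematicalPhysics.KineticTheory.HeatConduction.PhaseSpace N) (i : Fin N), |F z| + |Literature.MathematicalPhysics.KineticTheory.HeatConduction.partialP i F z| + |Literature.MathematicalPhysics.KineticTheory.HeatConduction.partialQ i F z| ≤ C * Real.exp (θ * P.hamiltonian N z)) ∧ (∀ z : Literature.MathematicalPhysics.KineticTheory.HeatConduction.PhaseSpace N, P.generator N T T F z = -(∑ i : Fin N, P.bondCurrent N i z)) ∧ D *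 (((N : ℝ) - 1) * T ^ 2) = ∫ z, F z * (∑ i : Fin N, P.bondCurrent N i z) ∂(MeasureTheory.volume.tilted fun x => -P.hamiltonian N x / T)

-- earlier OddChargeExists (stmt-AtomisticToContinuum-12119, replaced 2026-08-15T19:18:21Z -> stmt-AtomisticToContinuum-13511): retired by None — ∃ ω₂ lam β γ T : ℝ, 0 < ω₂ ∧ 0 < lam ∧ 0 < β ∧ 0 < γ ∧ 0 < T ∧ ∀ P : Literature.MathematicalPhysics.KineticTheory.HeatConduction.OscillatorChain, P = Literature.MathematicalPhysics.KineticTheory.HeatConduction.pinnedChain ω₂ lam β γ → (∃ (R : ℕ) (g : (Fin (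
/-- item stmt-AtomisticToContinuum-13511 · crux · rank 4 · closed · refuted by Summit.AtomisticToContinuum.FouriersLaw.Theorems.not_OddChargeExists @ 25ebc7474e19 (prover) · by planner
why it might fail: Expected false: no momentum-odd local conservation law is known or expected for the quartic pinned chain at any positive parameters (pinning destroys the harmonic/Toda charges); a NoLocalIntegrals-type classification refutes it outright.
sources: Mazur1969, Zotos2002, DicintioEtAl2018, Yamilov2006, LepriLiviPoliti2003
[crux] the EXISTENCE CLAUSE = kill switch (DISBELIEVED; filed so that the Mazur loophole becomes
decisive for the conjunct): ∃ ω₂, lam, β, γ, T > 0 with OddLocalCharge(ω₂,lam,β,γ,T) as in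
DressedCharge (odd polynomial finite-range density, infinite-chain local conservation law, extensive
finite-volume current overlap). Expected FALSE: pinning is believed to leave energy as the only
local conservation law (DicintioEtAl2018; MazurBoundBallisticNarrow (5)); its adversaries are the
classification statements of the no-hidden-charges / local-Ohm cards (an odd f = c·e_0 + (h −
h∘shift) + k forces c = k = 0 and Q_N telescopes to O(1) overlap). A proof at one parameter point
makes this route refute FouriersLaw; a refutation closes the route with the bridge items standing.
[difficulty: open-problem] -/
@[route_item "route-AtomisticToContinuum-HiddenChargeMazur"]
def OddChargeExists : Prop :=
  ∃ ω₂ lam β γ T : ℝ, 0 < ω₂ ∧ 0 < lam ∧ 0 < β ∧ 0 < γ ∧ 0 < T ∧ ∀ P : Literature.MathematicalPhysics.KineticTheory.HeatConduction.OscillatorChain, P = Literature.MathematicalPhysics.KineticTheory.HeatConduction.pinnedChain ω₂ lam β γ → (∃ (R : ℕ) (g : (Fin (2 * R + 1) → ℝ × ℝ) → ℝ) (ψ : (Fin (2 * (R + 1) + 1) → ℝ × ℝ) → ℝ), (∃ p : MvPolynomial (Fin (2 * R + 1) ⊕ Fin (2 * R + 1)) ℝ, ∀ y : Fin (2 * R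 + 1) → ℝ × ℝ, g y = MvPolynomial.eval (Sum.elim (fun i => (y i).1) (fun i => (y i).2)) p) ∧ (∃ p : MvPolynomial (Fin (2 * (R + 1) + 1) ⊕ Fin (2 * (R + 1) + 1)) ℝ, ∀ y : Fin (2 * (R + 1) + 1) → ℝ × ℝ, ψ y = MvPolynomial.eval (Sum.elim (fun i => (y i).1) (fun i => (y i).2)) p) ∧ (∀ y : Fin (2 * R + 1) → ℝ × ℝ, g (fun i => ((y i).1, -(y i).2)) = -g y) ∧ (∀ σ : ℤ → ℝ × ℝ, (∑' x : ℤ, ((σ x).2 * deriv (fun t => g (fun i : Fin (2 * R + 1) => Function.update σ x (t, (σ x).2) ((i : ℤ) - (R : ℕ)))) (σ x).1 + (-deriv P.U (σ x).1 + (deriv P.V ((σ (x + 1)).1 - (σ x).1) - deriv P.V ((σ x).1 - (σ (x - 1)).1))) * deriv (fun t => g (fun i : Fin (2 * R + 1) => Function.update σ x ((σ x).1, t) ((i : ℤ) - (R : ℕ)))) (σ x).2)) = ψ (fun i : Fin (2 * (R + 1) + 1) => σ ((i : ℤ) - (R + 1 : ℕ))) - ψ (fun i : Fin (2 * (R + 1)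 + 1) => σ ((i : ℤ) - (R + 1 : ℕ) + 1))) ∧ (∃ c : ℝ, 0 < c ∧ ∃ N₀ : ℕ, ∀ N : ℕ, N₀ ≤ N → c * (N : ℝ) ≤ |∫ z, (∑ i : Fin N, P.bondCurrent N i z) * (∑ x ∈ Finset.range (N - 2 * R), g (fun i => if h : x + i.val < N then (z.1 ⟨x + i.val, h⟩, z.2 ⟨x + i.val, h⟩) else (0, 0))) ∂(MeasureTheory.volume.tilted fun x => -P.hamiltonian N x / T)|))

-- earlier ThomsonBound (stmt-AtomisticToContinuum-12120, replaced 2026-08-15T19:18:21Z -> stmt-AtomisticToContinuum-13512): retired by None — ∀ ω₂ lam β γ T : ℝ, 0 < ω₂ → 0 < lam → 0 < β → 0 < γ → 0 < T → ∀ P : Literature.MathematicalPhysics.KineticTheory.HeatConduction.OscillatorChain, P = Literature.MathematicalPhysics.KineticTheory.HeatConduction.pinnedChain ω₂ lam β γ → ∀ (N : ℕ) (F G wL wR : Li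
/-- item stmt-AtomisticToContinuum-13512 · support · rank 9 · closed · proved by Summit.AtomisticToContinuum.FouriersLaw.Theorems.thomsonBound_proof @ 8fe631b975a2 (prover) · by planner
sources: BernardinOlla2011, KomorowskiLandimOlla2012, GaudilliereLandim2013
[support] card (V), static one-sided Thomson form (routine). For pinnedChain (all > 0), T > 0, any N
and C² functions F, G, wL, wR with a common e^(θH) bound (θ < 1/(2T)): if generator N T T F = −J
pointwise and G is dressed, {H_N,G} = T Σ_b ∂*_(p_b) w_b, then γ(∫ J G dGibbs)² ≤ (∫ F J dGibbs)·(T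
Σ_b ∫ (γ∂_(p_b)G + w_b)² dGibbs). Proof: ∫FJ = −∫F·LF = γTΣ_b∫(∂_bF)² (Liouville antisymmetry + OU
integration by parts in L²(Gibbs), in-tree pattern integral_liouville_mul_gibbsDensity /
integral_bath_mul_gibbsDensity extended to the e^(θH) class by cutoffs); ∫JG = −∫(LF)G = ∫F·{H,G} +
γTΣ_b∫∂_bF∂_bG = TΣ_b∫∂_bF(w_b + γ∂_bG) since poisson H G = A G in tree; Cauchy–Schwarz. Sharp at G
= F_odd, w_b = γ∂_(p_b)F_even. N = 0, 1 read 0 ≤ 0. [difficulty: M] -/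
@[route_item "route-AtomisticToContinuum-HiddenChargeMazur"]
def ThomsonBound : Prop :=
  ∀ ω₂ lam β γ T : ℝ, 0 < ω₂ → 0 < lam → 0 < β → 0 < γ → 0 < T → ∀ P : Literature.MathematicalPhysics.KineticTheory.HeatConduction.OscillatorChain, P = Literature.MathematicalPhysics.KineticTheory.HeatConduction.pinnedChain ω₂ lam β γ → ∀ (N : ℕ) (F G wL wR : Literature.MathematicalPhysics.KineticTheory.HeatConduction.PhaseSpace N → ℝ), ContDiff ℝ 2 F → ContDiff ℝ 2 G → ContDiff ℝ 2 wL → ContDiff ℝ 2 wR → (∃ C θ : ℝ, θ < 1 / (2 * T) ∧ ∀ (z : Literature.MathematicalPhysics.KineticTheory.HeatConduction.PhaseSpace N) (i : Fin N), |F z| + |G z| + |wL z| + |wR z| + |Literature.MathematicalPhysics.KineticTheory.HeatConduction.partialP i F z| + |Literature.MathematicalPhysics.KineticTheory.HeatConduction.partialQ i F z| + |Literature.MathematicalPhysics.KineticTheory.HeatConduction.partialP i G z| + |Literature.MathematicalPhysics.KineticTheory.HeatConduction.partialQ i G z| + |Literature.MathematicalPhysics.KineticTheory.HeatConduction.partialP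 i wL z| + |Literature.MathematicalPhysics.KineticTheory.HeatConduction.partialQ i wL z| + |Literature.MathematicalPhysics.KineticTheory.HeatConduction.partialP i wR z| + |Literature.MathematicalPhysics.KineticTheory.HeatConduction.partialQ i wR z| ≤ C * Real.exp (θ * P.hamiltonian N z)) → (∀ z : Literature.MathematicalPhysics.KineticTheory.HeatConduction.PhaseSpace N, P.generator N T T F z = -(∑ i : Fin N, P.bondCurrent N i z)) → (∀ z : Literature.MathematicalPhysics.KineticTheory.HeatConduction.PhaseSpace N, (∑ x : Fin N, (Literature.MathematicalPhysics.KineticTheory.HeatConduction.partialP x (P.hamiltonian N) z * Literature.MathematicalPhysics.KineticTheory.HeatConduction.partialQ x G z - Literature.MathematicalPhysics.KineticTheory.HeatConduction.partialQ x (P.hamiltonian N) z * Literature.MathematicalPhysics.KineticTheory.HeatConduction.partialP x G z)) = T * ∑ i : Fin N, ((if i.val = 0 then -Literature.MathematicalPhysics.KineticTheory.HeatConduction.partialP i wL z + z.2 i / T * wL z else 0) + (if i.val = N - 1 then -Literature.MathematicalPhysics.KineticTheory.HeatConduction.partialP i wR z + z.2 i / T * wR z else 0))) → γ * (∫ z,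 (∑ i : Fin N, P.bondCurrent N i z) * G z ∂(MeasureTheory.volume.tilted fun x => -P.hamiltonian N x / T)) ^ 2 ≤ (∫ z, F z * (∑ i : Fin N, P.bondCurrent N i z) ∂(MeasureTheory.volume.tilted fun x => -P.hamiltonian N x / T)) * (T * ∑ i : Fin N, ((if i.val = 0 then ∫ z, (γ * Literature.MathematicalPhysics.KineticTheory.HeatConduction.partialP i G z + wL z) ^ 2 ∂(MeasureTheory.volume.tilted fun x => -P.hamiltonian N x / T) else 0) + (if i.val = N - 1 then ∫ z, (γ * Literature.MathematicalPhysics.KineticTheory.HeatConduction.partialP i G z + wR z) ^ 2 ∂(MeasureTheory.volume.tilted fun x => -P.hamiltonian N x / T) else 0)))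

-- earlier OpenMazurBridge (stmt-AtomisticToContinuum-12121, replaced 2026-08-15T19:18:21Z -> stmt-AtomisticToContinuum-13513): retired by None — ∀ ω₂ lam β γ T : ℝ, 0 < ω₂ → 0 < lam → 0 < β → 0 < γ → 0 < T → ∀ P : Literature.MathematicalPhysics.KineticTheory.HeatConduction.OscillatorChain, P = Literature.MathematicalPhysics.KineticTheory.HeatConduction.pinnedChain ω₂ lam β γ → (∃ (R : ℕ) (g : (Fin (
/-- item stmt-AtomisticToContinuum-13513 · support · rank 9 · closed · moot by None · by planner
sources: KunduDharNarayan2009, Prosen2011, Mazur1969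
[support] THE INSTRUMENT, stated alone so positive routes and refuters can cite it: for pinnedChain
ω₂ lam β γ (all > 0) and T > 0, OddLocalCharge(ω₂,lam,β,γ,T) ⟹ ¬FouriersLawFor (pinnedChain ω₂ lam β
γ). Follows from StaticKubo, ThomsonBound, DressedCharge by BridgeGlue; contrapositively
FouriersLawFor ⇒ no odd polynomial local charge with extensive current overlap — the certified
NECESSARY condition, the open-chain reach the Mazur barrier lacked. [difficulty: M] -/
@[route_item "route-AtomisticToContinuum-HiddenChargeMazur"]
def OpenMazurBridge : Prop :=
  ∀ ω₂ lam β γ T : ℝ, 0 < ω₂ → 0 < lam → 0 < β → 0 < γ → 0 < T → ∀ P : Literature.MathematicalPhysics.KineticTheory.HeatConduction.OscillatorChain, P = Literature.MathematicalPhysics.KineticTheory.HeatConduction.pinnedChain ω₂ lam β γ → (∃ (R : ℕ) (g : (Fin (2 * R + 1) → ℝ × ℝ) → ℝ) (ψ : (Fin (2 * (R + 1) + 1) → ℝ × ℝ) → ℝ), (∃ p : MvPolynomial (Fin (2 * R + 1) ⊕ Fin (2 * R + 1)) ℝ, ∀ y : Fin (2 * R + 1) → ℝ × ℝ, g y = MvPolynomial.eval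 (Sum.elim (fun i => (y i).1) (fun i => (y i).2)) p) ∧ (∃ p : MvPolynomial (Fin (2 * (R + 1) + 1) ⊕ Fin (2 * (R + 1) + 1)) ℝ, ∀ y : Fin (2 * (R + 1) + 1) → ℝ × ℝ, ψ y = MvPolynomial.eval (Sum.elim (fun i => (y i).1) (fun i => (y i).2)) p) ∧ (∀ y : Fin (2 * R + 1) → ℝ × ℝ, g (fun i => ((y i).1, -(y i).2)) = -g y) ∧ (∀ σ : ℤ → ℝ × ℝ, (∑' x : ℤ, ((σ x).2 * deriv (fun t => g (fun i : Fin (2 * R + 1) => Function.update σ x (t, (σ x).2) ((i : ℤ) - (R : ℕ)))) (σ x).1 + (-deriv P.U (σ x).1 + (deriv P.V ((σ (x + 1)).1 - (σ x).1) - deriv P.V ((σ x).1 - (σ (x - 1)).1))) * deriv (fun t => g (fun i : Fin (2 * R + 1) => Function.update σ x ((σ x).1, t) ((i : ℤ) - (R : ℕ)))) (σ x).2)) = ψ (fun i : Fin (2 * (R + 1) + 1) => σ ((i : ℤ) - (R + 1 : ℕ))) - ψ (fun i : Fin (2 * (R + 1) + 1) => σ ((i : ℤ) - (R + 1 : ℕ)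 + 1))) ∧ (∃ c : ℝ, 0 < c ∧ ∃ N₀ : ℕ, ∀ N : ℕ, N₀ ≤ N → c * (N : ℝ) ≤ |∫ z, (∑ i : Fin N, P.bondCurrent N i z) * (∑ x ∈ Finset.range (N - 2 * R), g (fun i => if h : x + i.val < N then (z.1 ⟨x + i.val, h⟩, z.2 ⟨x + i.val, h⟩) else (0, 0))) ∂(MeasureTheory.volume.tilted fun x => -P.hamiltonian N x / T)|)) → ¬ P.FouriersLawFor

-- earlier NoOddChargeSmallRange (stmt-AtomisticToContinuum-12123, replaced 2026-08-15T19:18:21Z -> stmt-AtomisticToContinuum-13514): retired by None — ∀ ω₂ lam β γ T : ℝ, 0 < ω₂ → 0 < lam → 0 < β → 0 < γ → 0 < T → ∀ P : Literature.MathematicalPhysics.KineticTheory.HeatConduction.OscillatorChain, P = Literature.MathematicalPhysics.KineticTheory.HeatConduction.pinnedChain ω₂ lam β γ → ∀ (g : (Fin 3 → 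
/-- item stmt-AtomisticToContinuum-13514 · support · rank 9 · closed · moot by None · by planner
sources: Yamilov2006, DicintioEtAl2018, Mazur1969
[support] NEGATIVE SIDE of OddChargeExists in the first window (the card's detection protocol;
decidable by symbolic linear algebra; the cheapest falsifier recorded as an item): for all ω₂, lam,
β, γ, T > 0, every odd polynomial 3-site density g of total degree ≤ 4 with a local conservation law
of the infinite pinned chain (flux ψ polynomial on 5 sites) has sub-extensive finite-volume current
overlap (∀ c > 0 ∀ N₀ ∃ N ≥ N₀, |∫ J_N·Q_N dGibbs| < cN). Expected proof: (a) the nullspace of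
`liouvilleZ(g∘box₁) = ψ∘box₂ − ψ∘box₂∘shift` in coefficient space over ℝ(ω₂, lam, β) consists of
coboundaries once lam, β > 0 (the harmonic solution g = j_0, degree 2, must be seen to disappear;
mind non-generic parameter values); (b) coboundary charges telescope, Q_N = h(left window) − h(right
window), and E_N[J_N·(…)] = O(1) uniformly in N (momentum independence kills all but O(1) bonds;
uniform moments of the free-end Gibbs marginals). A counterexample at positive parameters flips the
route into a live refutation of the conjunct. [difficulty: M] -/
@[route_item "route-AtomisticToContinuum-HiddenChargeMazur"]
def NoOddChargeSmallRange : Prop :=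
  ∀ ω₂ lam β γ T : ℝ, 0 < ω₂ → 0 < lam → 0 < β → 0 < γ → 0 < T → ∀ P : Literature.MathematicalPhysics.KineticTheory.HeatConduction.OscillatorChain, P = Literature.MathematicalPhysics.KineticTheory.HeatConduction.pinnedChain ω₂ lam β γ → ∀ (g : (Fin 3 → ℝ × ℝ) → ℝ) (ψ : (Fin 5 → ℝ × ℝ) → ℝ), (∃ p : MvPolynomial (Fin 3 ⊕ Fin 3) ℝ, p.totalDegree ≤ 4 ∧ ∀ y : Fin 3 → ℝ × ℝ, g y = MvPolynomial.eval (Sum.elim (fun i => (y i).1) (fun i => (y i).2)) p) → (∃ p : MvPolynomial (Fin 5 ⊕ Fin 5) ℝ, ∀ y : Fin 5 → ℝ × ℝ, ψ y = MvPolynomial.eval (Sum.elim (fun i => (y i).1) (fun i => (y i).2)) p) → (∀ y : Fin 3 → ℝ × ℝ, g (fun i => ((y i).1, -(y i).2)) = -g y) → (∀ σ : ℤ → ℝ × ℝ, (∑' x : ℤ, ((σ x).2 * deriv (fun t => g (fun i : Fin 3 => Function.update σ x (t, (σ x).2) ((i : ℤ) - (1 : ℕ)))) (σ x).1 + (-deriv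 P.U (σ x).1 + (deriv P.V ((σ (x + 1)).1 - (σ x).1) - deriv P.V ((σ x).1 - (σ (x - 1)).1))) * deriv (fun t => g (fun i : Fin 3 => Function.update σ x ((σ x).1, t) ((i : ℤ) - (1 : ℕ)))) (σ x).2)) = ψ (fun i : Fin 5 => σ ((i : ℤ) - (2 : ℕ))) - ψ (fun i : Fin 5 => σ ((i : ℤ) - (2 : ℕ) + 1))) → ∀ c : ℝ, 0 < c → ∀ N₀ : ℕ, ∃ N : ℕ, N₀ ≤ N ∧ |∫ z, (∑ i : Fin N, P.bondCurrent N i z) * (∑ x ∈ Finset.range (N - 2 * 1), g (fun i => if h : x + i.val < N then (z.1 ⟨x + i.val, h⟩, z.2 ⟨x + i.val, h⟩) else (0, 0))) ∂(MeasureTheory.volume.tilted fun x => -P.hamiltonian N x / T)| < c * (N : ℝ)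

-- earlier BridgeGlue (stmt-AtomisticToContinuum-12122, replaced 2026-08-15T19:18:21Z -> stmt-AtomisticToContinuum-13515): retired by None — StaticKubo → ThomsonBound → DressedCharge → OpenMazurBridge
/-- item stmt-AtomisticToContinuum-13515 · support · rank 9 · closed · proved by Summit.AtomisticToContinuum.FouriersLaw.Theorems.hiddenChargeMazur_bridgeGlue_proof (prover) · by planner
sources: BonettoLebowitzReyBellet2000, KunduDharNarayan2009
[support] GLUE (~120 Lean lines, bookkeeping): StaticKubo → ThomsonBound → DressedCharge →
OpenMazurBridge. Given the charge at (ω₂,lam,β,γ,T), assume h : FouriersLawFor (pinnedChain …).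
Clause (i) of h gives weak-NESS uniqueness (μ = ν form) and, by choice, a steady-state family;
clause (ii) gives κ and D : ℕ → ℝ with the response limits at T and Tendsto D atTop (nhds (κ T)),
hence |D N| ≤ M. DressedCharge gives c, C, N₀; for N ≥ max N₀ 2 take F from StaticKubo (D := D N)
and G, wL, wR from DressedCharge (common growth constants by max); ThomsonBound yields γ(cN)² ≤
γ(∫JG)² ≤ D N·(N−1)T²·leak(γ) ≤ M(N−1)T²C(1+γ²) (leak ≥ 0 as a sum of integrals of squares; ∫FJ < 0
is already absurd), i.e. N ≤ M T² C(1+γ²)/(γc²)·(N−1)/N — false for large N. [difficulty: M] -/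
@[route_item "route-AtomisticToContinuum-HiddenChargeMazur"]
def BridgeGlue : Prop :=
  StaticKubo → (ThomsonBound → (DressedCharge → OpenMazurBridge))

/-- item stmt-AtomisticToContinuum-12124 · assembly · rank 1 · closed · proved by Summit.AtomisticToContinuum.FouriersLaw.Theorems.hiddenChargeMazur_assembly_proof (prover) · by planner
sources: BonettoLebowitzReyBellet2000, KunduDharNarayan2009
[assembly] StaticKubo → ThomsonBound → DressedCharge → OddChargeExists → ¬FouriersLaw (NEGATIVE
route: reached only if the disbelieved OddChargeExists is ever proved; the durable deliverables are
StaticKubo, ThomsonBound and OpenMazurBridge). -/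
@[route_item "route-AtomisticToContinuum-HiddenChargeMazur"]
def Assembly : Prop :=
  StaticKubo → ThomsonBound → DressedCharge → OddChargeExists → ¬ _root_.FouriersLaw

end Summit.AtomisticToContinuum.FouriersLaw.Theses.HiddenChargeMazur
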